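import Summits.BirchSwinnertonDyer.BirchSwinnertonDyer.Theorems.ErratumRoadFiveTwoVariableControlDualFinite
import Literature.Algebra.Module.CharacterModuleAnnihilator
import Mathlib.RingTheory.Ideal.Quotient.Basic
import Mathlib.RingTheory.Filtration
import Mathlib.LinearAlgebra.Isomorphisms
import Mathlib.GroupTheory.QuotientGroup.Finite
import HarnessLib

/-!
# Crux 4 `BSDpOnCellC` (stmt-BirchSwinnertonDyer-19034), line `telescope`, research node K2 (`stub_carrierDivInt` of v6 /
# `K2Mod.stub_branchFibreDiv` of `Cruxes/BSDpOnCellC/Lines/telescopeK2module.lean`): CONTROL WITH FINITE DEFECT ON BOTH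
# SIDES — the pure module algebra (Artin–Rees finiteness transfer; Pontryagin dual of a two-sided finite control map; finite
# generation without injectivity). Helper, `--supports stmt-BirchSwinnertonDyer-19034 --as helper`; closes nothing.

Ideator `bsd-idea-12` g34 (planner). A Theorems PORT, by name, of §2/§5/§6 of the critic-passed workfile
`Cruxes/BSDpOnCellC/K2ClassicalSketch.lean` v1.4 (idea card `Cruxes/BSDpOnCellC/Ideas/k2-classical.md`, critic `idea-crit-14`
V176/V187/V193 PASS), so that the K2 leaves (`Cruxes/BSDpOnCellC/Lines/telescopeK2leaves.lean`) and any v7 of the LEAD's skeleton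
can cite these lemmas BY NAME instead of carrying copies (LEAD `cruxlead-19034` g1 HANDOFF-FINAL NEXT (0)(a′)). Theorems only:
no definition, no named fact, no `sorry`, no instance, no notation. Statements and proofs are those of the sketch, unchanged;
only the namespace moved. Companion file (Selmer side, §1/§3/§4 of the sketch):
`Theorems/EisensteinPrimesBSDpOnCellCTelescopeK2WeightControl.lean`.

## What is proved (all unconditional; binders only)

* `finite_torsionBy_of_finite_quot` — over a Noetherian ring `R`, a finitely generated module `C` with finite `r`-cotorsion
  `C ⧸ r·C` has finite `r`-torsion `C[r]` (Artin–Rees, `Ideal.exists_pow_inf_eq_pow_smul`: `C[r] ∩ r^{k+1}C = 0`, so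
  `C[r] ↪ C ⧸ r^{k+1}C`, finite by induction on the `r`-adic filtration). In the line: `R = 𝒪₂ = ℤ_p⟦X′⟧`,
  `C = (M₂^{Γ_v})^∨`, `r = X′ − x_k`; converts "member-level invariants finite for every member" into "the control defect
  `C[π_k]` is finite for every member" (input (fin) of `ErratumThm23TwoVariable.ControlFiniteDefect`).
* `exists_quotSMulTop_linearMap_twoSided` — Pontryagin-dual form of two-sided finite control: from an additive `C`-semilinear
  `θ : N₁ → N₂` with `r • θ = 0`, FINITE kernel and range of finite index in `N₂[r]`, an `R`-linear
  `f : N₂^∨ ⧸ r·N₂^∨ → N₁^∨`, `f [χ] = χ ∘ θ`, with FINITE KERNEL AND FINITE COKERNEL (the tree's injective case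
  `ErratumThm23TwoVariable.ControlDualFinite.exists_quotSMulTop_linearMap_of_finite_index` applied to `θ̄ : N₁ ⧸ ker θ ↪ N₂`,
  composed with the injective dual of `N₁ ↠ N₁ ⧸ ker θ`, whose cokernel embeds in the finite `(ker θ)^∨`).
* `module_finite_characterModule_twoSided` — `N₂^∨` is finitely generated over the `(r)`-adically (pre)complete `S` as soon as
  `N₁^∨` is finitely generated over the Noetherian `R`, `N₂` is `r`-power torsion and `range θ` has finite index in `N₂[r]` —
  NO injectivity (the tree's `ControlDualFinite.module_finite_characterModule_of_finite_index` applied to `θ̄`).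

Where it is consumed: clauses (ctrl_k)/(reg_k)/(fg) of `K2Mod.stub_branchFibreDiv` (member control with finite two-sided defect
feeding `charIdeal`-divisibilities through `RetractionSpecialization`) and the D-0171 leaves N2/N3 of `Lines/telescopeK2leaves.lean`.

HONEST FRAMING: module algebra over binders; nothing about any curve, newform or `L`-function is asserted; BSD is proved for no
pair; no summit statement is proved by this file; closes: none.

## References
* [JetchevSkinnerWan2017] §3.4, Lemma 3.4.1 and the display before it (arXiv:1512.06894 p. 14).
* Artin–Rees: Mathlib `Ideal.exists_pow_inf_eq_pow_smul` ([AtiyahMacdonald1969] Cor. 10.10); [Matsumura1987] Theorem 8.4.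
-/

noncomputable section

-- D-0017: single-problem summit, the namespace repeats the problem name by design.
set_option linter.dupNamespace false
set_option autoImplicit false

open Literature.NumberTheory.EllipticCurves
open scoped Pointwise

universe u

namespace Summit.BirchSwinnertonDyer.BirchSwinnertonDyer.Theorems.TelescopeK2ControlAlgebra

/-! ## §A Finite cotorsion ⇒ finite torsion (Artin–Rees) -/

/-- **Finite `r`-cotorsion ⇒ finite `r`-torsion (PROVED).** For a finitely generated module `C` over a Noetherian
ring `R`: if `C ⧸ r·C` is finite then so is `C[r]`. Proof: Artin–Rees (`Ideal.exists_pow_inf_eq_pow_smul`) gives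
`C[r] ∩ r^{k+1}C = r·(C[r] ∩ r^k C) ⊆ r·C[r] = 0`, so `C[r] ↪ C ⧸ r^{k+1}C`, which is finite because
`C ⧸ r^{n+1}C` is an extension of `C ⧸ rⁿC` by a quotient of `C ⧸ rC` (induction on `n`). In the classical line
`R = 𝒪₂ = R₀⟦X′⟧`, `C = (M₂^{Γ_{K_𝔭̄}})^∨` (finitely generated over `R₀⟦X′⟧` because the tame character `ω` kills the
`𝐓⁺`-dual piece and the inertia relation `δ = (1+X′)^a (1+T)^b − 1` is `T`-distinguished on the `𝐓⁻`-dual piece) or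
`C = (M₂^{Γ_K})^∨`, `r = X′ − x_k`, and `C ⧸ rC` = the dual of the member's invariants (local anticyclotomic tower at 𝔭̄,
resp. global), finite for EVERY member (`k = 2`: Tate curve / `E(K^{ac}_∞)[p^∞]`; `k > 2`: Hodge–Tate weights); the
conclusion `C[r]` finite is the finiteness of the local control defect `M₂^{Γ_{K_𝔭̄}} ⧸ π_k` (input (fin) of the tree's
`ErratumThm23TwoVariable.ControlFiniteDefect.exists_controlMap_of_finite_defect` / `finite_selmer_torsion_quot`), resp.
of the global defect `δ₀(M₂^{Γ_K})` (`TorsionControl.cohomologyMap_torsionIncl_eq_zero_iff`). Pure Mathlib. [folklore] -/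
theorem finite_torsionBy_of_finite_quot {R : Type*} [CommRing R] [IsNoetherianRing R]
    {C : Type*} [AddCommGroup C] [Module R C] [Module.Finite R C]
    (r : R) (hfin : Finite (C ⧸ r • (⊤ : Submodule R C))) :
    Finite (Submodule.torsionBy R C r) := by
  classical
  set I : Ideal R := Ideal.span {r} with hI
  set N : Submodule R C := Submodule.torsionBy R C r with hN
  have hIpow : ∀ n : ℕ, I ^ n • (⊤ : Submodule R C) = (r ^ n) • (⊤ : Submodule R C) := fun n => by
    rw [hI, Ideal.span_singleton_pow, Submodule.ideal_span_singleton_smul]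
  -- all the quotients `C ⧸ rⁿ C` are finite
  have hq : ∀ n : ℕ, Finite (C ⧸ (r ^ n) • (⊤ : Submodule R C)) := by
    intro n
    induction n with
    | zero =>
        refine Finite.of_surjective (fun _ : Unit => (0 : C ⧸ (r ^ 0) • (⊤ : Submodule R C))) ?_
        intro x
        induction x using Submodule.Quotient.induction_on with
        | H c =>
          refine ⟨(), ?_⟩
          simp only
          symm
          rw [Submodule.Quotient.mk_eq_zero, pow_zero, one_smul]
          exact Submodule.mem_top
    | succ n ih =>
        set Q : Submodule R C := (r ^ (n + 1)) • (⊤ : Submodule R C) with hQ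
        set Q' : Submodule R C := (r ^ n) • (⊤ : Submodule R C) with hQ'
        have hle : Q ≤ Q' := by
          rintro x hx
          obtain ⟨c, -, rfl⟩ := (Submodule.mem_smul_pointwise_iff_exists _ _ _).mp hx
          refine (Submodule.mem_smul_pointwise_iff_exists _ _ _).mpr ⟨r • c, Submodule.mem_top, ?_⟩
          rw [pow_succ, mul_smul]
        set P : Submodule R (C ⧸ Q) := Q'.map Q.mkQ with hP
        have e := Submodule.quotientQuotientEquivQuotient Q Q' hle
        haveI hfinQP : Finite ((C ⧸ Q) ⧸ P) := Finite.of_equiv _ e.toEquiv.symm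
        -- `P` is the image of `c ↦ rⁿ c`, which factors through the finite `C ⧸ r C`
        let g : C →ₗ[R] C ⧸ Q := (r ^ n) • Q.mkQ
        have hg : ∀ c : C, g c = Q.mkQ ((r ^ n) • c) := fun c => by
          simp only [g, LinearMap.smul_apply, map_smul]
        have hker : r • (⊤ : Submodule R C) ≤ LinearMap.ker g := by
          rintro x hx
          obtain ⟨c, -, rfl⟩ := (Submodule.mem_smul_pointwise_iff_exists _ _ _).mp hx
          rw [LinearMap.mem_ker, hg, Submodule.mkQ_apply, Submodule.Quotient.mk_eq_zero]
          refine (Submodule.mem_smul_pointwise_iff_exists _ _ _).mpr ⟨c, Submodule.mem_top, ?_⟩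
          rw [pow_succ, mul_smul]
        let gbar : (C ⧸ r • (⊤ : Submodule R C)) →ₗ[R] C ⧸ Q := (r • (⊤ : Submodule R C)).liftQ g hker
        have hPle : P ≤ LinearMap.range gbar := by
          rintro x hx
          obtain ⟨c, hc, rfl⟩ := Submodule.mem_map.mp hx
          obtain ⟨c', -, rfl⟩ := (Submodule.mem_smul_pointwise_iff_exists _ _ _).mp hc
          refine ⟨Submodule.Quotient.mk c', ?_⟩
          exact (Submodule.liftQ_apply _ _ c').trans (hg c')
        haveI : Finite (LinearMap.range gbar) := by
          have : Finite (Set.range gbar) := Set.finite_range gbar |>.to_subtype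
          exact this
        haveI hfinP : Finite P := Finite.of_injective (Submodule.inclusion hPle) (Submodule.inclusion_injective hPle)
        haveI : Finite P.toAddSubgroup := hfinP
        haveI : Finite ((C ⧸ Q) ⧸ P.toAddSubgroup) := hfinQP
        exact Finite.of_addSubgroup_quotient P.toAddSubgroup
  -- Artin–Rees: `N ∩ r^{k+1} C = 0`
  obtain ⟨k, hk⟩ := Ideal.exists_pow_inf_eq_pow_smul I N
  have hbot : I ^ (k + 1) • (⊤ : Submodule R C) ⊓ N = ⊥ := by
    rw [hk (k + 1) (by omega), show k + 1 - k = 1 from by omega, pow_one]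
    refine eq_bot_iff.mpr ?_
    calc I • (I ^ k • ⊤ ⊓ N) ≤ I • N := Submodule.smul_mono le_rfl inf_le_right
      _ = r • N := by rw [hI, Submodule.ideal_span_singleton_smul]
      _ ≤ ⊥ := by
          rintro x hx
          obtain ⟨m, hm, rfl⟩ := (Submodule.mem_smul_pointwise_iff_exists _ _ _).mp hx
          rw [hN, Submodule.mem_torsionBy_iff] at hm
          simpa using hm
  -- `N ↪ C ⧸ r^{k+1} C`
  haveI := hq (k + 1)
  refine Finite.of_injective (fun x : N => ((r ^ (k + 1)) • (⊤ : Submodule R C)).mkQ (x : C)) ?_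
  intro x y hxy
  have hmem : (x : C) - y ∈ (r ^ (k + 1)) • (⊤ : Submodule R C) := by
    simpa [Submodule.mkQ_apply] using (Submodule.Quotient.eq _).mp hxy
  have hmemN : (x : C) - y ∈ N := N.sub_mem x.2 y.2
  have : (x : C) - y ∈ I ^ (k + 1) • (⊤ : Submodule R C) ⊓ N := ⟨by rw [hIpow]; exact hmem, hmemN⟩
  rw [hbot, Submodule.mem_bot, sub_eq_zero] at this
  exact Subtype.ext this

/-! ## §B Two-sided finite control, Pontryagin-dual side -/

section Dual

/-- **Pontryagin dual of a two-sided finite control map.** For an additive `C`-semilinear `θ : N₁ → N₂` with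
`r • θ = 0`, FINITE KERNEL and range of FINITE INDEX in `N₂[r]`, there is an `R`-linear
`f : N₂^∨ ⧸ r·N₂^∨ → N₁^∨` with `f [χ] = χ ∘ θ`, FINITE KERNEL and FINITE COKERNEL. (Apply the tree's injective case
`ControlDualFinite.exists_quotSMulTop_linearMap_of_finite_index` to `θ̄ : N₁ ⧸ ker θ ↪ N₂` and compose with the injective
dual of `N₁ ↠ N₁ ⧸ ker θ`, whose cokernel embeds in `(ker θ)^∨`, finite.) The dual form of §4: `X₂ ⧸ r X₂ → X(M₂[r])` has
finite kernel and cokernel. [cite: JetchevSkinnerWan2017, §3.4, Lemma 3.4.1 (arXiv:1512.06894 p. 14)] [folklore] -/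
theorem exists_quotSMulTop_linearMap_twoSided {R S : Type} [CommRing R] [CommRing S] (C : R →+* S) (r : S)
    {N₁ N₂ : Type} [AddCommGroup N₁] [Module R N₁] [AddCommGroup N₂] [Module S N₂] (θ : N₁ →+ N₂)
    (hθC : ∀ (a : R) (n : N₁), θ (a • n) = C a • θ n) (hθr : ∀ n : N₁, r • θ n = 0)
    (hker : Finite θ.ker)
    (hfin : Finite (↥(Submodule.torsionBy S N₂ r).toAddSubgroup ⧸
      (θ.range).addSubgroupOf (Submodule.torsionBy S N₂ r).toAddSubgroup)) :
    ∃ f : (letI : Module R (QuotSMulTop r (CharacterModule N₂)) := Module.compHom _ C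
          QuotSMulTop r (CharacterModule N₂) →ₗ[R] CharacterModule N₁),
      (∀ χ : CharacterModule N₂, f (Submodule.Quotient.mk χ) = χ.comp θ) ∧
      (letI : Module R (QuotSMulTop r (CharacterModule N₂)) := Module.compHom _ C
       Finite (LinearMap.ker f)) ∧
      (letI : Module R (QuotSMulTop r (CharacterModule N₂)) := Module.compHom _ C
       Finite (CharacterModule N₁ ⧸ LinearMap.range f)) := by
  classical
  letI : Module R (QuotSMulTop r (CharacterModule N₂)) := Module.compHom _ C
  -- the kernel as an `R`-submodule
  let K : Submodule R N₁ :=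
    { carrier := θ.ker
      add_mem' := fun ha hb => θ.ker.add_mem ha hb
      zero_mem' := θ.ker.zero_mem
      smul_mem' := fun a n hn => by
        change θ (a • n) = 0
        rw [hθC, show θ n = 0 from hn, smul_zero] }
  haveI hKfin : Finite K := Finite.of_equiv θ.ker (Equiv.subtypeEquivRight fun _ => Iff.rfl)
  -- `θ̄ : N₁ ⧸ K → N₂`
  let θbar : (N₁ ⧸ K) →+ N₂ := QuotientAddGroup.lift K.toAddSubgroup θ fun n hn => hn
  have hθbar : ∀ n : N₁, θbar (Submodule.Quotient.mk n) = θ n := fun _ => rfl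
  have hθbarC : ∀ (a : R) (q : N₁ ⧸ K), θbar (a • q) = C a • θbar q := by
    intro a q
    induction q using Submodule.Quotient.induction_on with
    | H n => rw [← Submodule.Quotient.mk_smul, hθbar, hθbar, hθC]
  have hθbarr : ∀ q : N₁ ⧸ K, r • θbar q = 0 := by
    intro q
    induction q using Submodule.Quotient.induction_on with
    | H n => rw [hθbar, hθr]
  have hinj : Function.Injective θbar := by
    intro q q' h
    induction q using Submodule.Quotient.induction_on with
    | H n =>
      induction q' using Submodule.Quotient.induction_on with
      | H n' =>
        rw [hθbar, hθbar] at h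
        refine (Submodule.Quotient.eq K).2 ?_
        change θ (n - n') = 0
        rw [map_sub, h, sub_self]
  have hrange : θbar.range = θ.range := by
    ext x
    constructor
    · rintro ⟨q, rfl⟩
      induction q using Submodule.Quotient.induction_on with
      | H n => exact ⟨n, (hθbar n).symm⟩
    · rintro ⟨n, rfl⟩
      exact ⟨Submodule.Quotient.mk n, hθbar n⟩
  have hfin' : Finite (↥(Submodule.torsionBy S N₂ r).toAddSubgroup ⧸
      (θbar.range).addSubgroupOf (Submodule.torsionBy S N₂ r).toAddSubgroup) := by
    rw [hrange]; exact hfin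
  obtain ⟨fbar, hsurj, hfbar, hkerfin⟩ :=
    Theorems.ErratumThm23TwoVariable.ControlDualFinite.exists_quotSMulTop_linearMap_of_finite_index
      C r θbar hθbarC hθbarr hinj hfin'
  -- compose with the (injective) dual of the projection
  let πd : CharacterModule (N₁ ⧸ K) →ₗ[R] CharacterModule N₁ := CharacterModule.dual K.mkQ
  have hπd : Function.Injective πd := CharacterModule.dual_injective_of_surjective _ (Submodule.mkQ_surjective K)
  refine ⟨πd ∘ₗ fbar, fun χ => ?_, ?_, ?_⟩
  · rw [LinearMap.comp_apply, hfbar]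
    rfl
  · rw [LinearMap.ker_comp_of_ker_eq_bot _ (LinearMap.ker_eq_bot.2 hπd)]
    exact hkerfin
  · -- the cokernel of `πd ∘ fbar` is that of `πd`, which embeds in `K^∨`
    rw [LinearMap.range_comp_of_range_eq_top _ (LinearMap.range_eq_top.2 hsurj)]
    let ρ : CharacterModule N₁ →ₗ[R] CharacterModule K := CharacterModule.dual K.subtype
    have hle : LinearMap.ker ρ ≤ LinearMap.range πd := by
      intro χ hχ
      have hχK : ∀ n ∈ K.toAddSubgroup, χ n = 0 := fun n hn => by
        have := DFunLike.congr_fun (LinearMap.mem_ker.1 hχ) ⟨n, hn⟩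
        exact this
      refine ⟨QuotientAddGroup.lift K.toAddSubgroup χ hχK, ?_⟩
      ext n
      rfl
    haveI : Finite (CharacterModule K) := (Literature.Algebra.Module.natCard_characterModule_le (M := K)).1
    haveI : Finite (LinearMap.range ρ) := inferInstance
    haveI : Finite (CharacterModule N₁ ⧸ LinearMap.ker ρ) :=
      Finite.of_equiv _ (LinearMap.quotKerEquivRange ρ).toEquiv.symm
    exact Finite.of_surjective (Submodule.factor hle) (Submodule.factor_surjective hle)

end Dual

/-! ## §C Finite generation, two-sided case -/

section FiniteGeneration

/-- **`N₂^∨` is finitely generated over `S`** when `S` is `(r)`-adically (pre)complete, `N₂` is `r`-power torsion,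
`N₁^∨` is finitely generated over a Noetherian `R`, and the additive `C`-semilinear `θ : N₁ → N₂` (`rθ = 0`) has
finite-index range in `N₂[r]` — with NO injectivity (the kernel may be anything: `(N₁ ⧸ ker θ)^∨ ↪ N₁^∨` is finitely
generated by Noetherianity); the tree's injective case `ControlDualFinite.module_finite_characterModule_of_finite_index`
applied to `θ̄ : N₁ ⧸ ker θ ↪ N₂`. In the classical line: `X₂ = XBig κ ρ₂ 𝔭̄ ∅` is finitely generated over
`Λ₂ = 𝒪₂⟦T⟧` — indeed over `𝒪₂⟦T⟧` in the variable `X′ − x_k ∈ 𝒪₂`, `M₂` being `X′`-primary — as soon as ONE member's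
`X` is (C3, f.g. part; cf. `ErratumThm23TwoVariable.ControlFiniteDefect.module_finite_XBig_iterate_of_finite_defect`).
[cite: JetchevSkinnerWan2017, §3.4 (arXiv:1512.06894 p. 14)] [cite: Matsumura1987, Theorem 8.4] -/
theorem module_finite_characterModule_twoSided {R S : Type*} [CommRing R] [CommRing S] [IsNoetherianRing R]
    (C : R →+* S) (r : S) [IsPrecomplete (Ideal.span {r}) S]
    {N₁ N₂ : Type*} [AddCommGroup N₁] [Module R N₁] [AddCommGroup N₂] [Module S N₂] (θ : N₁ →+ N₂)
    (hθC : ∀ (a : R) (n : N₁), θ (a • n) = C a • θ n) (hθr : ∀ n : N₁, r • θ n = 0)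
    (hfin : Finite (↥(Submodule.torsionBy S N₂ r).toAddSubgroup ⧸
      (θ.range).addSubgroupOf (Submodule.torsionBy S N₂ r).toAddSubgroup))
    (htors : ∀ y : N₂, ∃ n : ℕ, r ^ n • y = 0)
    [Module.Finite R (CharacterModule N₁)] :
    Module.Finite S (CharacterModule N₂) := by
  classical
  let K : Submodule R N₁ :=
    { carrier := θ.ker
      add_mem' := fun ha hb => θ.ker.add_mem ha hb
      zero_mem' := θ.ker.zero_mem
      smul_mem' := fun a n hn => by
        change θ (a • n) = 0
        rw [hθC, show θ n = 0 from hn, smul_zero] }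
  let θbar : (N₁ ⧸ K) →+ N₂ := QuotientAddGroup.lift K.toAddSubgroup θ fun n hn => hn
  have hθbar : ∀ n : N₁, θbar (Submodule.Quotient.mk n) = θ n := fun _ => rfl
  have hθbarC : ∀ (a : R) (q : N₁ ⧸ K), θbar (a • q) = C a • θbar q := by
    intro a q
    induction q using Submodule.Quotient.induction_on with
    | H n => rw [← Submodule.Quotient.mk_smul, hθbar, hθbar, hθC]
  have hθbarr : ∀ q : N₁ ⧸ K, r • θbar q = 0 := by
    intro q
    induction q using Submodule.Quotient.induction_on with
    | H n => rw [hθbar, hθr]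
  have hinj : Function.Injective θbar := by
    intro q q' h
    induction q using Submodule.Quotient.induction_on with
    | H n =>
      induction q' using Submodule.Quotient.induction_on with
      | H n' =>
        rw [hθbar, hθbar] at h
        refine (Submodule.Quotient.eq K).2 ?_
        change θ (n - n') = 0
        rw [map_sub, h, sub_self]
  have hrange : θbar.range = θ.range := by
    ext x
    constructor
    · rintro ⟨q, rfl⟩
      induction q using Submodule.Quotient.induction_on with
      | H n => exact ⟨n, (hθbar n).symm⟩
    · rintro ⟨n, rfl⟩
      exact ⟨Submodule.Quotient.mk n, hθbar n⟩
  have hfin' : Finite (↥(Submodule.torsionBy S N₂ r).toAddSubgroup ⧸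
      (θbar.range).addSubgroupOf (Submodule.torsionBy S N₂ r).toAddSubgroup) := by
    rw [hrange]; exact hfin
  -- `(N₁ ⧸ K)^∨ ↪ N₁^∨` is finitely generated (Noetherian `R`)
  haveI : Module.Finite R (CharacterModule (N₁ ⧸ K)) :=
    Module.Finite.of_injective (CharacterModule.dual K.mkQ)
      (CharacterModule.dual_injective_of_surjective _ (Submodule.mkQ_surjective K))
  exact Theorems.ErratumThm23TwoVariable.ControlDualFinite.module_finite_characterModule_of_finite_index
    C r θbar hθbarC hθbarr hinj hfin' htors

end FiniteGeneration

end Summit.BirchSwinnertonDyer.BirchSwinnertonDyer.Theorems.TelescopeK2ControlAlgebra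

end
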